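import Mathlib
import HarnessLib
import Summits.HubbardSuperconductivity.HubbardSuperconductivity.Theorems.KLProgrammeKLRegimeSplitTwoLegPieceFnBounds
import Summits.HubbardSuperconductivity.HubbardSuperconductivity.Theorems.KLProgrammeKLRegimeSplitFrameFnLemmas
import Summits.HubbardSuperconductivity.HubbardSuperconductivity.Theorems.KLProgrammeKLRegimeSplitFrameFnMin

/-!
# Route `KLProgramme`, crux K3 — gen-5 ENGINE child (stmt-…-19918 `KLRegimeEngineV14`, `stub_twoLeg_step`, clause `TwoLegSizesMST`):
# (E3a-MS) FROM A PROFILE SPLIT — the STRUCTURAL top of the (P4) assembly (recipe (L)+(F), plan g12 STATUS l.1769)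

Seat hubbard-kl-k3c3-p1 (g3).  `TwoLegSizesMSFn … K n` asks for slot functions `lp : ℕ → FrameFn` with `ℓ_n(K) = lp n + Σ_{m ∈ Ioc n N} lp m`
pointwise, every `lp m` a symmetric `C⁴` frame, `‖Dʲ lp n‖ ≤ twoLegBar j n` and `‖Dʲ lp m‖ ≤ msBar n · Gfr j · uPow j U · 4^{(j−2)m}` (`j ≤ 4`).  The
(L)+(F) witness (MS-DESIGN-NOTE §3) produces the slots as G-EXTENSIONS `lp m := klFrameExtFn μ (p m)` of ANGULAR PROFILES `p m` (the scale-`n`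
profile through the level-shifted, low-part-augmented depth-`n` curve, and the telescoped differences through the high parts), whose
sum is the increment profile `δ` of the piece (`ℓ_n(K) = klFrameExtFn μ δ`, k3c3-p1 g2).  This file proves the STRUCTURAL step once and for all:

**`twoLegSizesMSFn_of_profile_split`**: if `klTwoLegPieceFn … K n = klFrameExtFn μ δ`, `δ = p n + Σ_{m ∈ Ioc n (nScales β)} p m` with every `p m`
`C⁴`, `2π`-periodic, even and `θ ↦ π/2 − θ` symmetric, with centred angular sizes `‖Dⁱ(p m − mean)‖ ≤ Gs m j` (`i ≤ j ≤ 4`) and the two FITS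
`[j=0]|mean (p n)| + C_j(X)·Gs n j ≤ twoLegBar j n`, `[j=0]|mean (p m)| + C_j(X)·Gs m j ≤ msBar n·Gfr j·uPow j U·4^{(j−2)m}` (`C_j(X)` = the numeral of
k3c3-p1's symbol bound `norm_iteratedFDeriv_onM_piece_le`, `X ≥ sup_{l ≤ 4}‖Dˡχ₂‖`), then `TwoLegSizesMSFn L M G Q R β U μ K n`.

So the analytic content of (P4) is reduced to the angular term table of MS-DESIGN-NOTE §3 (profiles only).  Also: `klFrameExtFn_finset_sum`
(linearity over finite sums).  Proofs only; nothing about the model.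
-/

noncomputable section

namespace Summit.HubbardSuperconductivity.HubbardSuperconductivity.Theorems.KLRegimeSplit

set_option linter.dupNamespace false -- summit = problem name (single-conjunct summit), D-0017

open Real Finset MeasureTheory Literature.MathematicalPhysics.QuantumLattice Literature.MathematicalPhysics.QuantumLattice.FermiRG
open Summit.HubbardSuperconductivity.HubbardSuperconductivity.Theorems.KLProgrammeLegKernels

/-! ## §1 Linearity of the G-extension over finite sums -/

/-- **`klFrameExtFn μ (Σ_{i ∈ s} f i) = Σ_{i ∈ s} klFrameExtFn μ (f i)`** (pointwise), for continuous profiles. -/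
theorem klFrameExtFn_finset_sum (μ : ℝ) {ι : Type*} (s : Finset ι) (f : ι → ℝ → ℝ) (hf : ∀ i ∈ s, Continuous (f i))
    (p : Fin 2 → ℝ) : klFrameExtFn μ (fun θ => ∑ i ∈ s, f i θ) p = ∑ i ∈ s, klFrameExtFn μ (f i) p := by
  classical
  induction s using Finset.induction_on with
  | empty => simp [klFrameExtFn_zero]
  | insert a s ha ih =>
    have hfa : Continuous (f a) := hf a (Finset.mem_insert_self a s)
    have hfs : ∀ i ∈ s, Continuous (f i) := fun i hi => hf i (Finset.mem_insert_of_mem hi)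
    have hsum : Continuous fun θ => ∑ i ∈ s, f i θ := continuous_finsetSum s fun i hi => hfs i hi
    simp_rw [Finset.sum_insert ha]
    rw [klFrameExtFn_add μ (hfa.intervalIntegrable _ _) (hsum.intervalIntegrable _ _)]
    show klFrameExtFn μ (f a) p + klFrameExtFn μ (fun θ => ∑ i ∈ s, f i θ) p = _
    rw [ih hfs]

/-! ## §2 (E3a-MS) from a profile split -/

section MS

variable {L M : ℕ} [NeZero L] [NeZero M] {G : GeoConsts} {Q : EngConsts} {R : RenConsts} {β U μ : ℝ}

/-- The numeral of the symbol bound `norm_iteratedFDeriv_onM_piece_le` at order `j` with cutoff size `X`: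
`C_j(X) = (j!)²·(2·j!·X·200ʲ)·(4 + max 1 ((j−1)!/(8/5)))ʲ` (an expression, not a new definition). -/
theorem pieceNumeral_nonneg (j : ℕ) {X : ℝ} (hX : 0 ≤ X) :
    0 ≤ (j.factorial : ℝ) ^ 2 * (2 * j.factorial * X * 200 ^ j) * (4 + max 1 (((j - 1).factorial : ℝ) / (8 / 5))) ^ j := by
  positivity

/-- **(E3a-MS) FROM A PROFILE SPLIT.**  See the module docstring.  The slots are `lp m := klFrameExtFn μ (p m)` for every `m`; the decomposition is
the linearity of the G-extension; symmetry and smoothness of the slots are k3c3-p1 g2's `isSymmetricFrame_piece` / `contDiff_onM_piece`; the sizes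
are `norm_iteratedFDeriv_onM_piece_le` fed with the centred angular sizes `Gs m j` and closed by the two fits. -/
theorem twoLegSizesMSFn_of_profile_split (hμ : μ ∈ klWindowC) {K : FrameFn} {n : ℕ} {δ : ℝ → ℝ}
    (hP : klTwoLegPieceFn L M β U μ K n = klFrameExtFn μ δ) (p : ℕ → ℝ → ℝ)
    (hsplit : ∀ θ, δ θ = p n θ + ∑ m ∈ Ioc n (nScales β), p m θ)
    (hcd : ∀ m, ContDiff ℝ 4 (p m)) (hper : ∀ m, Function.Periodic (p m) (2 * π))
    (heven : ∀ m θ, p m (-θ) = p m θ) (hdiag : ∀ m θ, p m (π / 2 - θ) = p m θ)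
    {X : ℝ} (hX : ∀ l ≤ 4, ∀ x : ℝ, ‖iteratedFDeriv ℝ l salmhoferCutoff x‖ ≤ X)
    (Gs : ℕ → ℕ → ℝ)
    (hGs : ∀ m, ∀ j ≤ 4, ∀ i ≤ j, ∀ t : ℝ, ‖iteratedFDeriv ℝ i (fun t => p m t - klAngularMean (p m)) t‖ ≤ Gs m j)
    (hfit_n : ∀ j ≤ 4, (if j = 0 then |klAngularMean (p n)| else 0) +
      (j.factorial : ℝ) ^ 2 * (2 * j.factorial * X * 200 ^ j) * Gs n j * (4 + max 1 (((j - 1).factorial : ℝ) / (8 / 5))) ^ j ≤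
        twoLegBar G Q U j n)
    (hfit_m : ∀ m ∈ Ioc n (nScales β), ∀ j ≤ 4, (if j = 0 then |klAngularMean (p m)| else 0) +
      (j.factorial : ℝ) ^ 2 * (2 * j.factorial * X * 200 ^ j) * Gs m j * (4 + max 1 (((j - 1).factorial : ℝ) / (8 / 5))) ^ j ≤
        msBar G Q U n * (R.Gfr j * uPow j U * (4 : ℝ) ^ (((j : ℤ) - 2) * m))) :
    TwoLegSizesMSFn L M G Q R β U μ K n := by
  have hμ' : -(39 / 10 : ℝ) ≤ μ := by have := hμ.1; norm_num at this ⊢; linarith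
  -- the slots
  refine ⟨fun m => klFrameExtFn μ (p m), fun q => ?_, fun m => ⟨?_, ?_⟩, fun j hj q => ?_, fun m hm j hj q => ?_⟩
  · -- decomposition
    have hn : n ∉ Ioc n (nScales β) := by simp
    have hδ : δ = fun θ => ∑ m ∈ insert n (Ioc n (nScales β)), p m θ := by
      funext θ; rw [Finset.sum_insert hn]; exact hsplit θ
    rw [hP, hδ, klFrameExtFn_finset_sum μ _ _ (fun m _ => (hcd m).continuous), Finset.sum_insert hn]
  · exact isSymmetricFrame_piece rfl (hper m) (heven m) (hdiag m) hμ'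
  · exact contDiff_onM_piece rfl (N' := 4) (by exact_mod_cast hcd m) (hper m) hμ
  · have h := norm_iteratedFDeriv_onM_piece_le (P := klFrameExtFn μ (p n)) rfl (N := 4) (by exact_mod_cast hcd n) (hper n)
      (j := j) (by exact_mod_cast hj) hμ (hGs n j hj) (fun l hl x => hX l (hl.trans hj) x) q
    exact h.trans (hfit_n j hj)
  · have h := norm_iteratedFDeriv_onM_piece_le (P := klFrameExtFn μ (p m)) rfl (N := 4) (by exact_mod_cast hcd m) (hper m)
      (j := j) (by exact_mod_cast hj) hμ (hGs m j hj) (fun l hl x => hX l (hl.trans hj) x) q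
    exact h.trans (hfit_m m hm j hj)

/-- **At `K.eval`** (the V13/V14 slot text `TwoLegSizesMST … K n := TwoLegSizesMSFn … K.eval n`): the same statement for a `TrigPolyC4v` frame. -/
theorem twoLegSizesMST_of_profile_split (hμ : μ ∈ klWindowC) {K : TrigPolyC4v} {n : ℕ} {δ : ℝ → ℝ}
    (hP : klTwoLegPieceFn L M β U μ K.eval n = klFrameExtFn μ δ) (p : ℕ → ℝ → ℝ)
    (hsplit : ∀ θ, δ θ = p n θ + ∑ m ∈ Ioc n (nScales β), p m θ)
    (hcd : ∀ m, ContDiff ℝ 4 (p m)) (hper : ∀ m, Function.Periodic (p m) (2 * π))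
    (heven : ∀ m θ, p m (-θ) = p m θ) (hdiag : ∀ m θ, p m (π / 2 - θ) = p m θ)
    {X : ℝ} (hX : ∀ l ≤ 4, ∀ x : ℝ, ‖iteratedFDeriv ℝ l salmhoferCutoff x‖ ≤ X)
    (Gs : ℕ → ℕ → ℝ)
    (hGs : ∀ m, ∀ j ≤ 4, ∀ i ≤ j, ∀ t : ℝ, ‖iteratedFDeriv ℝ i (fun t => p m t - klAngularMean (p m)) t‖ ≤ Gs m j)
    (hfit_n : ∀ j ≤ 4, (if j = 0 then |klAngularMean (p n)| else 0) +
      (j.factorial : ℝ) ^ 2 * (2 * j.factorial * X * 200 ^ j) * Gs n j * (4 + max 1 (((j - 1).factorial : ℝ) / (8 / 5))) ^ j ≤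
        twoLegBar G Q U j n)
    (hfit_m : ∀ m ∈ Ioc n (nScales β), ∀ j ≤ 4, (if j = 0 then |klAngularMean (p m)| else 0) +
      (j.factorial : ℝ) ^ 2 * (2 * j.factorial * X * 200 ^ j) * Gs m j * (4 + max 1 (((j - 1).factorial : ℝ) / (8 / 5))) ^ j ≤
        msBar G Q U n * (R.Gfr j * uPow j U * (4 : ℝ) ^ (((j : ℤ) - 2) * m))) :
    TwoLegSizesMST L M G Q R β U μ K n :=
  twoLegSizesMSFn_of_profile_split hμ hP p hsplit hcd hper heven hdiag hX Gs hGs hfit_n hfit_m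

end MS

end Summit.HubbardSuperconductivity.HubbardSuperconductivity.Theorems.KLRegimeSplit

end
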